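import Literature.NumberTheory.EllipticCurves.ModularSymbolsProofs
import Mathlib.Analysis.SpecialFunctions.Elliptic.Weierstrass
import HarnessLib

/-!
# Line `kummer` on crux `StarGO2Sigma` (item stmt-BirchSwinnertonDyer-27046, route `EisensteinDepletionAtTwo`):
# stub `stub_kummerParityHom` — the Kummer parity of the cusp symbols `q·{∞, γ∞}_f` is multiplicative on `Γ₀(N)`

Cell `bsd-rank2` (HOME run/shared/lean/pub/bsd-rank2/), seat `bsd-rank2-eng-2` GEN 16; registered stub 2 of planner p2 GEN 32's
line `kummer` (skeleton `line-kummer.lean`, namespace `…Cruxes.StarGO2Sigma.Kummer`), proved VERBATIM (name + signature).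
Content: for a period pair `L₀` (lattice `Λ = ℤω₁ ⊕ ℤω₂`) and `λ ∈ Λ` with `λ/2 ∉ Λ`, the subgroup `ℤλ + 2Λ` has index `2`
in `Λ`: writing `λ = aω₁ + bω₂` (`a, b` not both even), `mω₁ + nω₂ ∈ ℤλ + 2Λ ⟺ mb − na` is even
(`mem_halfLattice_iff_even`), a PARITY FUNCTIONAL, additive in `(m, n)`; hence for `u, v ∈ Λ`:
`u + v ∈ ℤλ + 2Λ ⟺ (u ∈ ℤλ + 2Λ ⟺ v ∈ ℤλ + 2Λ)` (`halfLattice_add_iff`).  With Manin's additivity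
`{∞, γδ∞}_f = {∞, γ∞}_f + {∞, δ∞}_f` (TREE `cuspSymbol_mul_holds`) and `q·Λ_f ⊆ Λ` this is the stub.
HONEST FRAMING: elementary bookkeeping stub of an OPEN crux; StarGO2Sigma / E1M_NSF / BSD are NOT proved by this file
(PARTITION D-0054: none — r_an ≥ 2 axis S0, door T-r3₂).

References: Ju. I. Manin, *Parabolic points and zeta functions of modular curves*, Izv. 36 (1972), §1.5–1.7 (Prop. 1.4,
Thm. 1.6) [Manin1972]; J. E. Cremona, *Algorithms for Modular Elliptic Curves* (1997), §2.8, §2.10 [CremonaAlgorithms1997].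
-/

set_option linter.dupNamespace false
set_option autoImplicit false

noncomputable section

namespace Summit.BirchSwinnertonDyer.BirchSwinnertonDyer.Theorems.DepletionAtTwo.KummerStubs

open scoped MatrixGroups
open CongruenceSubgroup
open Literature.NumberTheory.EllipticCurves
open Literature.NumberTheory.EllipticCurves.ModularForms

/-! ### §1 The index-2 subgroup `ℤλ + 2Λ` of a rank-2 lattice -/

/-- Integer coordinates in `Λ = ℤω₁ ⊕ ℤω₂` are unique (`ω₁, ω₂` are `ℝ`-linearly independent). [folklore] -/
private theorem coord_unique (L : PeriodPair) {m n m' n' : ℤ}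
    (h : (m : ℂ) * L.ω₁ + n * L.ω₂ = m' * L.ω₁ + n' * L.ω₂) : m = m' ∧ n = n' := by
  have e := LinearIndependent.pair_iff.mp L.indep ((m - m' : ℤ) : ℝ) ((n - n' : ℤ) : ℝ) (by
    rw [Complex.real_smul, Complex.real_smul]
    push_cast
    linear_combination h)
  obtain ⟨e1, e2⟩ := e
  constructor
  · have : (m - m' : ℤ) = 0 := by exact_mod_cast e1
    omega
  · have : (n - n' : ℤ) = 0 := by exact_mod_cast e2
    omega

/-- **The parity functional of `ℤλ + 2Λ`.**  For `λ = aω₁ + bω₂ ∈ Λ` with `a, b` not both even and `z = mω₁ + nω₂`: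
`z ∈ ℤλ + 2Λ` (i.e. `z = kλ + 2w`, `w ∈ Λ`) iff `mb − na` is even. [cite: CremonaAlgorithms1997, §2.8 (period lattices; index-2 sublattices)] -/
theorem mem_halfLattice_iff_even (L : PeriodPair) {a b : ℤ} (hab : ¬ (Even a ∧ Even b)) (m n : ℤ) :
    (∃ k : ℤ, ∃ w ∈ L.lattice, (m : ℂ) * L.ω₁ + n * L.ω₂ = (k : ℂ) * (a * L.ω₁ + b * L.ω₂) + 2 * w) ↔
      Even (m * b - n * a) := by
  constructor
  · rintro ⟨k, w, hw, h⟩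
    obtain ⟨c, d, rfl⟩ := PeriodPair.mem_lattice.mp hw
    have hc := coord_unique L (m := m) (n := n) (m' := k * a + 2 * c) (n' := k * b + 2 * d)
      (by push_cast; linear_combination h)
    obtain ⟨rfl, rfl⟩ := hc
    exact ⟨c * b - d * a, by ring⟩
  · rintro ⟨r, hr⟩
    rcases Int.even_or_odd a with ⟨s, hs⟩ | ⟨s, hs⟩
    · -- `a = 2s` even, so `b = 2t + 1` is odd and `m` is even; take `k = n`
      have hb : ¬ Even b := fun h => hab ⟨⟨s, hs⟩, h⟩
      obtain ⟨t, ht⟩ := Int.not_even_iff_odd.mp hb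
      refine ⟨n, ((r - m * t : ℤ) : ℂ) * L.ω₁ + ((-(n * t) : ℤ) : ℂ) * L.ω₂,
        PeriodPair.mem_lattice.mpr ⟨r - m * t, -(n * t), rfl⟩, ?_⟩
      -- `m = 2(r - m t) + 2 n s`... from `m b − n a = 2r`, `a = 2s`, `b = 2t+1`: `m = 2r + 2ns·… `
      have hm : (m : ℤ) = 2 * r - 2 * m * t + 2 * n * s := by
        have := hr; rw [hs, ht] at this; linear_combination this
      have hmC : (m : ℂ) = 2 * r - 2 * m * t + 2 * n * s := by exact_mod_cast hm
      have haC : (a : ℂ) = s + s := by exact_mod_cast hs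
      have hbC : (b : ℂ) = 2 * t + 1 := by exact_mod_cast ht
      push_cast
      rw [haC, hbC]
      linear_combination hmC * L.ω₁
    · -- `a = 2s + 1` odd; take `k = m`
      refine ⟨m, ((-(m * s) : ℤ) : ℂ) * L.ω₁ + ((-r - n * s : ℤ) : ℂ) * L.ω₂,
        PeriodPair.mem_lattice.mpr ⟨-(m * s), -r - n * s, rfl⟩, ?_⟩
      have hrC : (m : ℂ) * b - n * a = r + r := by exact_mod_cast hr
      have haC : (a : ℂ) = 2 * s + 1 := by exact_mod_cast hs
      push_cast
      rw [haC] at hrC ⊢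
      linear_combination (-1 : ℂ) * hrC * L.ω₂

/-- **`ℤλ + 2Λ` has index `2`: membership of a sum.**  For `λ ∈ Λ` with `λ/2 ∉ Λ` and `u, v ∈ Λ`:
`u + v ∈ ℤλ + 2Λ ⟺ (u ∈ ℤλ + 2Λ ⟺ v ∈ ℤλ + 2Λ)`. [cite: CremonaAlgorithms1997, §2.8] -/
theorem halfLattice_add_iff (L : PeriodPair) {lam : ℂ} (hlam : lam ∈ L.lattice) (hlam2 : lam / 2 ∉ L.lattice)
    {u v : ℂ} (hu : u ∈ L.lattice) (hv : v ∈ L.lattice) :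
    (∃ k : ℤ, ∃ w ∈ L.lattice, u + v = (k : ℂ) * lam + 2 * w) ↔
      ((∃ k : ℤ, ∃ w ∈ L.lattice, u = (k : ℂ) * lam + 2 * w) ↔
        (∃ k : ℤ, ∃ w ∈ L.lattice, v = (k : ℂ) * lam + 2 * w)) := by
  obtain ⟨a, b, rfl⟩ := PeriodPair.mem_lattice.mp hlam
  obtain ⟨m, n, rfl⟩ := PeriodPair.mem_lattice.mp hu
  obtain ⟨m', n', rfl⟩ := PeriodPair.mem_lattice.mp hv
  have hab : ¬ (Even a ∧ Even b) := by
    rintro ⟨⟨s, hs⟩, ⟨t, ht⟩⟩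
    apply hlam2
    refine PeriodPair.mem_lattice.mpr ⟨s, t, ?_⟩
    have hsC : (a : ℂ) = s + s := by exact_mod_cast hs
    have htC : (b : ℂ) = t + t := by exact_mod_cast ht
    rw [hsC, htC]; ring
  have e : ((m : ℂ) * L.ω₁ + n * L.ω₂) + (m' * L.ω₁ + n' * L.ω₂) =
      ((m + m' : ℤ) : ℂ) * L.ω₁ + ((n + n' : ℤ) : ℂ) * L.ω₂ := by push_cast; ring
  rw [e, mem_halfLattice_iff_even L hab, mem_halfLattice_iff_even L hab, mem_halfLattice_iff_even L hab,
    show (m + m') * b - (n + n') * a = (m * b - n * a) + (m' * b - n' * a) by ring, Int.even_add]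

/-! ### §2 The stub -/

/-- **Stub `stub_kummerParityHom` of line `kummer` (crux StarGO2Sigma, item 27046), VERBATIM.**  If `q·Λ_f ⊆ Λ_{W₀}`
and `λ ∈ Λ_{W₀}` with `λ/2 ∉ Λ_{W₀}`, the Kummer parity `[q·{∞, γ∞}_f ∈ ℤλ + 2Λ_{W₀}]` is multiplicative in
`γ ∈ Γ₀(N)`: Manin's `{∞, γδ∞} = {∞, γ∞} + {∞, δ∞}` (`cuspSymbol_mul_holds`) and the index-2 count
`halfLattice_add_iff`. [cite: Manin1972, Prop. 1.4 / Thm. 1.6] [cite: CremonaAlgorithms1997, §2.8, §2.10] -/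
theorem stub_kummerParityHom :
    ∀ ⦃N : ℕ⦄ [NeZero N] (f : CuspForm (Gamma0 N) 2) (L₀ : PeriodPair) (q : ℚ),
      (∀ z ∈ periodLattice f, (q : ℂ) * z ∈ L₀.lattice) →
      ∀ (lam : ℂ), lam ∈ L₀.lattice → lam / 2 ∉ L₀.lattice →
      ∀ γ δ : Gamma0 N,
        ((∃ k : ℤ, ∃ w ∈ L₀.lattice, (q : ℂ) * cuspSymbol f (γ * δ) = (k : ℂ) * lam + 2 * w) ↔
          ((∃ k : ℤ, ∃ w ∈ L₀.lattice, (q : ℂ) * cuspSymbol f γ = (k : ℂ) * lam + 2 * w) ↔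
            (∃ k : ℤ, ∃ w ∈ L₀.lattice, (q : ℂ) * cuspSymbol f δ = (k : ℂ) * lam + 2 * w))) := by
  intro N _ f L₀ q hin lam hlam hlam2 γ δ
  rw [cuspSymbol_mul_holds f γ δ, mul_add]
  exact halfLattice_add_iff L₀ hlam hlam2 (hin _ (cuspSymbol_mem_periodLattice f γ))
    (hin _ (cuspSymbol_mem_periodLattice f δ))

end Summit.BirchSwinnertonDyer.BirchSwinnertonDyer.Theorems.DepletionAtTwo.KummerStubs

end
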